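import Literature.Geometry.Lorentzian.AsymptoticallyFlatCompletenessWeak
import Literature.Geometry.Riemannian.GradientEstimateIntegration
import Literature.AlgebraicTopology.FundamentalGroup.SphereSimplyConnected
import Mathlib.Analysis.Convex.Contractible
import Mathlib.Topology.Homotopy.Product
import Mathlib.AlgebraicTopology.FundamentalGroupoid.SimplyConnected
import HarnessLib

/-!
# Far out in an asymptotically flat end: loop-trivial regions containing large metric balls

The hypothesis `hend` of `InitialDataSet.simplyConnectedSpace_of_kids_of_far_balls`
(`KIDSimplyConnected.lean`: complete data carrying translational Killing initial data are
simply connected as soon as, for every radius, some metric ball of that radius lies in a set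
all of whose loops are null-homotopic) is verified here for asymptotically flat data, from the
structure of an asymptotically flat end `e : AFEnd X` (`chart : U ≅ {x ∈ ℝ³ | R < ‖x‖}`, closed
at infinity) and the order-zero decay of the metric:

* `simplyConnectedSpace_exteriorBall` — the exterior `{R < ‖x‖}` of a ball in `ℝ³` (`R ≥ 0`)
  is simply connected: polar coordinates identify it with `S² × (R, ∞)`, and `S²` is simply
  connected (Hatcher 2002, Prop. 1.14; the tree's `simplyConnectedSpace_sphere`);
* `AFEnd.homotopicRel_const_of_forall_mem_far` — hence every loop in a far region
  `e.far R₂` (`R₂ ≥ R`) is null-homotopic rel endpoints in `X` (read it in the chart, contract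
  it in the exterior of the ball, push the homotopy back by the inverse chart);
* `AFEnd.exists_edist_ball_subset_far` — if the metric obeys the order-zero decay of
  `IsStronglyAsymptoticallyFlatWith` on `e`, then every far region contains `h`-balls of every
  radius: the smoothed coordinate radius of `AsymptoticallyFlatCompleteness.lean` (Gordon's
  proper function) is `C¹` with `h`-bounded gradient, hence Lipschitz for the Riemannian
  distance (`ofReal_abs_sub_le_mul_riemEDist`), unbounded on the end, with superlevel sets
  inside the far regions;
* `AFEnd.exists_far_loopTrivial_ball` — the packaged hypothesis `hend` for data asymptotically
  flat of order `α > 0` on `e`.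

Everything is proved; no definitions, no named facts (D-0026).

## References

* R. Beig, P. T. Chruściel, J. Math. Phys. 37 (1996) 1939–1961, Thm. 4.1 (hypotheses: "each of
  the ends `Σ_i` is diffeomorphic to `ℝ³ ∖ B(R_i)`") and its proof, §4. [BeigChrusciel1996]
* A. Hatcher, *Algebraic Topology*, CUP 2002, Prop. 1.14. [HatcherAT2002]
* W. B. Gordon, Proc. Amer. Math. Soc. 37 (1973) 221–225 (the smoothed proper function).
  [Gordon1973]
* R. Schoen, S.-T. Yau, Comm. Math. Phys. 65 (1979) 45–76, p. 63. [SchoenYauPMT1979]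
-/

noncomputable section

open Bundle Set Function Filter Manifold Metric
open scoped Manifold ContDiff Topology NNReal

namespace Literature.Geometry.Lorentzian

/-! ### The exterior of a ball in `ℝ³` is simply connected -/

/-- A product of simply connected spaces is simply connected (private copy of the folklore
lemma of `Literature/Topology/FourManifolds/SphereCapComplement.lean`, outside this file's
import cone). [folklore] -/
private theorem simplyConnectedSpace_prod' {α β : Type*} [TopologicalSpace α] [TopologicalSpace β]
    [SimplyConnectedSpace α] [SimplyConnectedSpace β] : SimplyConnectedSpace (α × β) := by
  rw [simply_connected_iff_paths_homotopic]
  refine ⟨inferInstance, ?_⟩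
  rintro ⟨a₁, b₁⟩ ⟨a₂, b₂⟩
  refine ⟨fun p q => ?_⟩
  rw [← Path.Homotopic.prod_projLeft_projRight p, ← Path.Homotopic.prod_projLeft_projRight q,
    Subsingleton.elim (Path.Homotopic.projLeft p) (Path.Homotopic.projLeft q),
    Subsingleton.elim (Path.Homotopic.projRight p) (Path.Homotopic.projRight q)]

/-- **The exterior `{x ∈ ℝ³ | R < ‖x‖}` of a ball (`R ≥ 0`) is simply connected**: polar
coordinates `x ↦ (x/‖x‖, ‖x‖)` are a homeomorphism onto `S² × (R, ∞)`, the `2`-sphere is simply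
connected (Hatcher 2002, Prop. 1.14; `simplyConnectedSpace_sphere`) and the ray is convex.
[cite: HatcherAT2002, Prop. 1.14] -/
theorem simplyConnectedSpace_exteriorBall {R : ℝ} (hR : 0 ≤ R) :
    SimplyConnectedSpace {x : E3 // R < ‖x‖} := by
  haveI : Fact (Module.finrank ℝ E3 = 2 + 1) := ⟨by simp⟩
  haveI : SimplyConnectedSpace (sphere (0 : E3) 1) :=
    Literature.AlgebraicTopology.FundamentalGroup.simplyConnectedSpace_sphere le_rfl
  haveI : ContractibleSpace (Ioi R) := (convex_Ioi R).contractibleSpace ⟨R + 1, by simp⟩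
  haveI : SimplyConnectedSpace (sphere (0 : E3) 1 × Ioi R) := simplyConnectedSpace_prod'
  have hpos : ∀ x : {x : E3 // R < ‖x‖}, 0 < ‖(x : E3)‖ := fun x ↦ hR.trans_lt x.2
  have hmem : ∀ p : sphere (0 : E3) 1 × Ioi R, R < ‖(p.2 : ℝ) • (p.1 : E3)‖ := fun p ↦ by
    rw [norm_smul, Real.norm_eq_abs, abs_of_pos (hR.trans_lt p.2.2), norm_eq_of_mem_sphere p.1,
      mul_one]
    exact p.2.2
  -- polar coordinates
  let Φ : {x : E3 // R < ‖x‖} ≃ₜ (sphere (0 : E3) 1 × Ioi R) :=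
    { toFun := fun x ↦ (⟨‖(x : E3)‖⁻¹ • (x : E3), by
          rw [mem_sphere_zero_iff_norm, norm_smul, norm_inv, norm_norm,
            inv_mul_cancel₀ (hpos x).ne']⟩, ⟨‖(x : E3)‖, x.2⟩)
      invFun := fun p ↦ ⟨(p.2 : ℝ) • (p.1 : E3), hmem p⟩
      left_inv := fun x ↦ by
        apply Subtype.ext
        show ‖(x : E3)‖ • (‖(x : E3)‖⁻¹ • (x : E3)) = x
        rw [smul_smul, mul_inv_cancel₀ (hpos x).ne', one_smul]
      right_inv := fun p ↦ by
        obtain ⟨u, r⟩ := p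
        have hr : 0 < (r : ℝ) := hR.trans_lt r.2
        have hn : ‖(r : ℝ) • (u : E3)‖ = r := by
          rw [norm_smul, Real.norm_eq_abs, abs_of_pos hr, norm_eq_of_mem_sphere u, mul_one]
        refine Prod.ext (Subtype.ext ?_) (Subtype.ext ?_)
        · show ‖(r : ℝ) • (u : E3)‖⁻¹ • ((r : ℝ) • (u : E3)) = u
          rw [hn, smul_smul, inv_mul_cancel₀ hr.ne', one_smul]
        · exact hn
      continuous_toFun := by
        refine Continuous.prodMk (Continuous.subtype_mk ?_ _) (Continuous.subtype_mk ?_ _)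
        · exact (continuous_subtype_val.norm.inv₀ fun x ↦ (hpos x).ne').smul
            continuous_subtype_val
        · exact continuous_subtype_val.norm
      continuous_invFun := Continuous.subtype_mk
        ((continuous_subtype_val.comp continuous_snd).smul
          (continuous_subtype_val.comp continuous_fst)) hmem }
  exact Φ.toHomotopyEquiv.simplyConnectedSpace_iff.2 inferInstance

/-! ### Loops far out in an asymptotically flat end are null-homotopic -/

namespace AFEnd

variable {X : Type} [TopologicalSpace X] [ChartedSpace E3 X]

/-- **Loops in a far region of an asymptotically flat end are null-homotopic** (rel endpoints, in
`X`): the far region `{R₂ < ‖x‖}` (`R₂ ≥ R`) is carried by the chart diffeomorphically onto the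
exterior of a ball in `ℝ³`, which is simply connected (`simplyConnectedSpace_exteriorBall`), and
the null-homotopy there is pushed back into `X` by the inverse chart. (The topological input
"each of the ends `Σ_i` is diffeomorphic to `ℝ³ ∖ B(R_i)`" of Beig–Chruściel, J. Math. Phys. 37
(1996), Thm. 4.1.) [cite: BeigChrusciel1996, Thm. 4.1 (hypotheses)] -/
theorem homotopicRel_const_of_forall_mem_far (e : AFEnd X) {R₂ : ℝ} (hR₂ : e.R ≤ R₂)
    (γ : C(unitInterval, X)) (hγ : ∀ t, γ t ∈ e.far R₂) {y : X} (h0 : γ 0 = y) (h1 : γ 1 = y) :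
    γ.HomotopicRel (ContinuousMap.const unitInterval y) {0, 1} := by
  haveI := simplyConnectedSpace_exteriorBall (R := R₂) (e.R_pos.le.trans hR₂)
  -- membership in the end and in the far region, pointwise
  have hU : ∀ t, γ t ∈ (e.U : Set X) := fun t ↦ e.far_subset R₂ (hγ t)
  have hfar : ∀ t, R₂ < ‖(e.chart ⟨γ t, hU t⟩ : E3)‖ := by
    intro t
    obtain ⟨z, hz, hzt⟩ := hγ t
    have : z = ⟨γ t, hU t⟩ := Subtype.ext hzt
    rw [← this]
    exact hz
  -- the loop read in the chart, as a loop in the exterior of the ball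
  set T := {x : E3 // R₂ < ‖x‖}
  have hcU : Continuous fun t : unitInterval ↦ (⟨γ t, hU t⟩ : e.U) :=
    γ.continuous.subtype_mk _
  set γT : unitInterval → T := fun t ↦ ⟨(e.chart ⟨γ t, hU t⟩ : E3), hfar t⟩ with hγT
  have hγTc : Continuous γT :=
    ((continuous_subtype_val.comp e.chart.continuous).comp hcU).subtype_mk _
  -- the inverse chart as a continuous map `T → X`
  set g : C(T, X) := ⟨fun x ↦ e.dataChart ⟨x.1, lt_of_le_of_lt hR₂ x.2⟩,
    e.contMDiff_dataChart.continuous.comp (continuous_subtype_val.subtype_mk _)⟩ with hg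
  have hgγ : ∀ t, g (γT t) = γ t := by
    intro t
    show e.dataChart ⟨(e.chart ⟨γ t, hU t⟩ : E3), _⟩ = γ t
    have h2 : (⟨(e.chart ⟨γ t, hU t⟩ : E3), lt_of_le_of_lt hR₂ (hfar t)⟩ : exteriorRegion e.R) =
        e.chart ⟨γ t, hU t⟩ := Subtype.ext rfl
    rw [h2, e.dataChart_chart]
  -- the loop in `T` is null-homotopic there; push the homotopy to `X`
  set a : T := γT 0 with ha
  have hend0 : γT 0 = a := rfl
  have hend1 : γT 1 = a := by
    apply Subtype.ext
    show (e.chart ⟨γ 1, hU 1⟩ : E3) = (e.chart ⟨γ 0, hU 0⟩ : E3)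
    have : (⟨γ 1, hU 1⟩ : e.U) = ⟨γ 0, hU 0⟩ := Subtype.ext (h1.trans h0.symm)
    rw [this]
  set pT : Path a a := ⟨⟨γT, hγTc⟩, hend0, hend1⟩ with hpT
  have hnull : pT.Homotopic (Path.refl a) := SimplyConnectedSpace.paths_homotopic pT (Path.refl a)
  have hmap := hnull.map g
  have hga : g a = y := (hgγ 0).trans h0
  have e1 : ((pT.map g.continuous) : C(unitInterval, X)) = γ := by
    ext t
    exact hgγ t
  have e2 : (((Path.refl a).map g.continuous) : C(unitInterval, X)) =
      ContinuousMap.const unitInterval y := by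
    ext t
    exact hga
  have h3 : ((pT.map g.continuous) : C(unitInterval, X)).HomotopicRel
      (((Path.refl a).map g.continuous) : C(unitInterval, X)) {0, 1} := hmap
  rwa [e1, e2] at h3


/-! ### Large balls far out in a sole asymptotically flat end -/

section FarBalls

variable [IsManifold (𝓡 3) ∞ X] {e : AFEnd X} {D : InitialDataSet (𝓡 3) X}

/-- **Far out in a sole asymptotically flat end there are metric balls of every radius.** If
the metric of `D` satisfies the order-zero decay of `IsStronglyAsymptoticallyFlatWith` on the end
`e` (`β ≥ 0`) and `e` is the only end, then for every far region `{R₂ < ‖x‖}` and every radius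
`ρ₀` some `h`-ball of radius `ρ₀` lies in it. Proof: the smoothed coordinate radius
`ϱ = Θ ∘ chart` of `AsymptoticallyFlatCompleteness.lean` (`exists_radius_norm_sq_le`,
`exists_cutoff`: `Θ` is `L₀`-Lipschitz, vanishes on `‖y‖ ≤ R₁ + 1`, `Θ y ≥ ‖y‖ − R₁ − 2`),
extended by `0`, is `C¹` on `X` with `|dϱ(v)| ≤ L₀√2 |v|_h` (the chart norm is dominated by
`h` far out), hence `L₀√2`-Lipschitz for the Riemannian distance
(`ofReal_abs_sub_le_mul_riemEDist`); its superlevel sets `{ϱ > L₀ (R₂ − R₁ − 1)}` lie in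
`{R₂ < ‖x‖}` (`Θ y ≤ L₀ (‖y‖ − R₁ − 1)`), and `ϱ` is unbounded on the end, so the ball of
radius `ρ₀` about a point with `ϱ` large enough lies in the far region. (Gordon 1973, p. 222;
Schoen–Yau 1979, p. 63: the uniform equivalence of `ds²` with the Euclidean metric on the end.)
[cite: Gordon1973, Theorem (proof)] -/
theorem exists_edist_ball_subset_far [D.metric.HasLeviCivita] {M β γ : ℝ} {nh nk : ℕ}
    (hβ : 0 ≤ β) (haf : e.IsStronglyAsymptoticallyFlatWith D M β γ nh nk) (R₂ ρ₀ : ℝ) :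
    ∃ y : X, {q | D.metric.edist D.isRiemannian_metric y q < ENNReal.ofReal ρ₀} ⊆ e.far R₂ := by
  classical
  obtain ⟨R₁, hR₁, hR₁0, hnorm⟩ := exists_radius_norm_sq_le hβ haf
  obtain ⟨Θ, L₀, hΘd, hΘL, hΘ0, hΘge⟩ := exists_cutoff R₁ hR₁0
  -- the smoothed coordinate radius, extended by zero
  set ϱ : X → ℝ := fun q ↦ if hq : q ∈ e.U then Θ (e.chart ⟨q, hq⟩ : E3) else 0 with hϱ_def
  set Ψ : e.U → E3 := fun q ↦ (e.chart q : E3) with hΨ_def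
  have hϱU : ∀ q : e.U, ϱ q = Θ (Ψ q) := fun q ↦ by
    simp only [hϱ_def, dif_pos q.2, hΨ_def]
  have hϱval : (fun q : e.U ↦ ϱ q) = Θ ∘ Ψ := funext hϱU
  set C₁ : Set X := ((↑) : e.U → X) '' (e.chart ⁻¹' {x | R₁ + 1 / 2 ≤ ‖(x : E3)‖}) with hC₁_def
  have hC₁ : IsClosed C₁ := e.isClosed_far _ (by linarith)
  have hϱC : ∀ q ∈ C₁ᶜ, ϱ q = 0 := by
    intro q hq
    by_cases hqU : q ∈ e.U
    · have hlt : ‖(e.chart ⟨q, hqU⟩ : E3)‖ < R₁ + 1 / 2 := by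
        by_contra hle
        exact hq ⟨⟨q, hqU⟩, le_of_not_gt hle, rfl⟩
      rw [hϱU ⟨q, hqU⟩]
      exact hΘ0 _ (by simp only [hΨ_def]; linarith)
    · simp only [hϱ_def, dif_neg hqU]
  have hϱC' : ∀ q ∈ C₁ᶜ, ϱ =ᶠ[𝓝 q] fun _ ↦ 0 := fun q hq ↦
    Filter.eventuallyEq_of_mem (hC₁.isOpen_compl.mem_nhds hq) hϱC
  -- it is `C¹`
  have hΨd : ContMDiff (𝓡 3) 𝓘(ℝ, E3) 1 Ψ :=
    (contMDiff_subtype_val.comp e.chart.contMDiff).of_le (by simp)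
  have hϱval_d : ContMDiff (𝓡 3) 𝓘(ℝ, ℝ) 1 (fun q : e.U ↦ ϱ q) := by
    rw [hϱval]
    exact hΘd.contMDiff.comp hΨd
  have hϱd1 : ContMDiff (𝓡 3) 𝓘(ℝ, ℝ) 1 ϱ := by
    intro q
    by_cases hq : q ∈ C₁
    · obtain ⟨z, -, rfl⟩ := hq
      exact contMDiffAt_subtype_iff.1 (hϱval_d z)
    · exact contMDiffAt_const.congr_of_eventuallyEq (hϱC' q hq)
  have hϱd : ∀ q, MDifferentiableAt (𝓡 3) 𝓘(ℝ, ℝ) ϱ q := fun q ↦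
    (hϱd1 q).mdifferentiableAt one_ne_zero
  -- the gradient bound `|dϱ(v)| ≤ L₀ √2 |v|_h`
  have hL₀ : ∀ y, ‖fderiv ℝ Θ y‖ ≤ L₀ := fun y ↦ norm_fderiv_le_of_lipschitz ℝ hΘL
  have hgrad : ∀ (q : X) (v : TangentSpace (𝓡 3) q),
      |mvfderiv (𝓡 3) ϱ q v| ≤ (L₀ * Real.sqrt 2 : ℝ) * Real.sqrt (D.metric.val q v v) := by
    intro q v
    by_cases hq : q ∈ C₁
    · obtain ⟨z, hz, rfl⟩ := hq
      have hz' : R₁ + 1 / 2 ≤ ‖Ψ z‖ := hz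
      have hΨz : MDifferentiableAt (𝓡 3) 𝓘(ℝ, E3) Ψ z := (hΨd z).mdifferentiableAt one_ne_zero
      have hΘz : MDifferentiableAt 𝓘(ℝ, E3) 𝓘(ℝ, ℝ) Θ (Ψ z) :=
        (hΘd.contMDiff (Ψ z)).mdifferentiableAt one_ne_zero
      have hw : mfderiv (𝓡 3) 𝓘(ℝ, E3) Ψ z v = mfderiv (𝓡 3) (𝓡 3) e.chart z v := by
        have hc : MDifferentiableAt (𝓡 3) (𝓡 3) e.chart z :=
          e.chart.contMDiff.mdifferentiableAt (by simp)
        have h1 : mfderiv (𝓡 3) 𝓘(ℝ, E3) Ψ z =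
            (mfderiv (𝓡 3) (𝓡 3) (Subtype.val : exteriorRegion e.R → E3) (e.chart z)).comp
              (mfderiv (𝓡 3) (𝓡 3) e.chart z) :=
          mfderiv_comp z (hasMFDerivAt_subtypeVal (e.chart z)).mdifferentiableAt hc
        rw [h1, mfderiv_subtypeVal]
        rfl
      have hmv : mvfderiv (𝓡 3) ϱ (z : X) v =
          fderiv ℝ Θ (Ψ z) (mfderiv (𝓡 3) (𝓡 3) e.chart z v) := by
        show mfderiv (𝓡 3) 𝓘(ℝ, ℝ) ϱ (z : X) v = _
        rw [← mfderiv_comp_subtypeVal (hϱd z), show (ϱ ∘ Subtype.val : e.U → ℝ) = Θ ∘ Ψ from hϱval,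
          mfderiv_comp z hΘz hΨz, mfderiv_eq_fderiv]
        exact congrArg (fderiv ℝ Θ (Ψ z)) hw
      set w : E3 := mfderiv (𝓡 3) (𝓡 3) e.chart z v with hw_def
      have h1 : |fderiv ℝ Θ (Ψ z) w| ≤ L₀ * ‖w‖ := by
        rw [← Real.norm_eq_abs]
        exact (ContinuousLinearMap.le_opNorm _ _).trans
          (mul_le_mul_of_nonneg_right (hL₀ _) (norm_nonneg _))
      have h2 : ‖w‖ ^ 2 ≤ 2 * D.metric.val (z : X) v v := by
        have h3 := hnorm (Ψ z) (by linarith) w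
        rwa [hw_def, hCoeff_chart_apply_mfderiv] at h3
      have h4 : ‖w‖ ≤ Real.sqrt 2 * Real.sqrt (D.metric.val (z : X) v v) := by
        rw [← Real.sqrt_mul zero_le_two, ← Real.sqrt_sq (norm_nonneg w)]
        exact Real.sqrt_le_sqrt h2
      rw [hmv]
      calc |fderiv ℝ Θ (Ψ z) w| ≤ L₀ * ‖w‖ := h1
        _ ≤ L₀ * (Real.sqrt 2 * Real.sqrt (D.metric.val (z : X) v v)) := by gcongr
        _ = L₀ * Real.sqrt 2 * Real.sqrt (D.metric.val (z : X) v v) := by ring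
    · rw [mvfderiv_congr_of_eventuallyEq (hϱC' q hq), mvfderiv_const]
      simp only [zero_apply, abs_zero]
      positivity
  -- `Θ y ≤ L₀ (‖y‖ − R₁ − 1)` for `‖y‖ ≥ R₁ + 1` (Lipschitz bound from the sphere `‖y‖ = R₁ + 1`)
  have hΘle : ∀ y : E3, R₁ + 1 ≤ ‖y‖ → Θ y ≤ L₀ * (‖y‖ - R₁ - 1) := by
    intro y hy
    have hypos : 0 < ‖y‖ := by linarith
    set y₀ : E3 := ((R₁ + 1) / ‖y‖) • y with hy₀
    have hn₀ : ‖y₀‖ = R₁ + 1 := by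
      rw [hy₀, norm_smul, Real.norm_eq_abs, abs_of_pos (by positivity), div_mul_cancel₀ _ hypos.ne']
    have hΘ₀ : Θ y₀ = 0 := hΘ0 y₀ hn₀.le
    have hdist : dist y y₀ = ‖y‖ - R₁ - 1 := by
      rw [dist_eq_norm, hy₀, show y - ((R₁ + 1) / ‖y‖) • y = (1 - (R₁ + 1) / ‖y‖) • y by
        rw [sub_smul, one_smul], norm_smul, Real.norm_eq_abs, abs_of_nonneg (by
          rw [sub_nonneg, div_le_one hypos]; exact hy), sub_mul, one_mul,
        div_mul_cancel₀ _ hypos.ne']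
      ring
    have h := hΘL.dist_le_mul y y₀
    rw [hΘ₀, dist_eq_norm, sub_zero, Real.norm_eq_abs, hdist] at h
    exact (le_abs_self _).trans h
  -- superlevel sets of `ϱ` lie in far regions
  set R₂' : ℝ := max R₂ (R₁ + 1) with hR₂'
  set s₂ : ℝ := L₀ * (R₂' - R₁ - 1) with hs₂
  have hsuper : ∀ q, s₂ < ϱ q → q ∈ e.far R₂ := by
    intro q hq
    have hs₂0 : 0 ≤ s₂ := mul_nonneg L₀.2 (by rw [hR₂']; linarith [le_max_right R₂ (R₁ + 1)])
    have hqU : q ∈ e.U := by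
      by_contra hqU
      have : ϱ q = 0 := by simp only [hϱ_def, dif_neg hqU]
      linarith
    set z : e.U := ⟨q, hqU⟩ with hz
    have hϱq : ϱ q = Θ (Ψ z) := hϱU z
    have hbig : R₁ + 1 ≤ ‖Ψ z‖ := by
      by_contra hlt
      have : Θ (Ψ z) = 0 := hΘ0 _ (le_of_lt (not_le.1 hlt))
      linarith
    have hle := hΘle (Ψ z) hbig
    have hgt : R₂' < ‖Ψ z‖ := by
      by_contra hle'
      have h1 : L₀ * (‖Ψ z‖ - R₁ - 1) ≤ L₀ * (R₂' - R₁ - 1) :=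
        mul_le_mul_of_nonneg_left (by linarith [not_lt.1 hle']) L₀.2
      linarith
    exact ⟨z, lt_of_le_of_lt (le_max_left _ _) hgt, rfl⟩
  -- a point far out, with `ϱ` large
  by_cases hρ₀ : ρ₀ ≤ 0
  · obtain ⟨z₁, hz₁⟩ := exists_norm_eq E3 (show (0 : ℝ) ≤ e.R + 1 by linarith [e.R_pos])
    refine ⟨e.dataChart ⟨z₁, by show e.R < ‖z₁‖; rw [hz₁]; linarith⟩, fun q hq ↦ ?_⟩
    have : ENNReal.ofReal ρ₀ = 0 := ENNReal.ofReal_eq_zero.2 hρ₀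
    rw [mem_setOf_eq, this] at hq
    exact absurd hq ENNReal.not_lt_zero
  have hρ₀' : 0 < ρ₀ := lt_of_not_ge hρ₀
  set L : ℝ≥0 := L₀ * Real.toNNReal (Real.sqrt 2) with hL
  have hLcoe : (L : ℝ) = L₀ * Real.sqrt 2 := by
    rw [hL, NNReal.coe_mul, Real.coe_toNNReal _ (Real.sqrt_nonneg 2)]
  set s : ℝ := (L : ℝ) * ρ₀ + s₂ + 1 with hs
  set r : ℝ := max (R₁ + 3 + s) (e.R + 1) with hr
  have hrR : e.R < r := by rw [hr]; linarith [le_max_right (R₁ + 3 + s) (e.R + 1)]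
  obtain ⟨z₀, hz₀⟩ := exists_norm_eq E3 (e.R_pos.trans hrR).le
  set zfar : exteriorRegion e.R := ⟨z₀, by show e.R < ‖z₀‖; rw [hz₀]; exact hrR⟩ with hzfar
  have hnz : ‖(zfar : E3)‖ = r := hz₀
  set y : X := e.dataChart zfar with hy
  have hϱy : s < ϱ y := by
    have h1 : ϱ y = Θ (zfar : E3) := by
      have h2 : y = ((e.chart.symm zfar : e.U) : X) := rfl
      rw [h2, hϱU (e.chart.symm zfar)]
      simp [hΨ_def]
    rw [h1]
    have h3 := hΘge (zfar : E3)
    rw [hnz] at h3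
    have h4 : R₁ + 3 + s ≤ r := le_max_left _ _
    linarith
  refine ⟨y, fun q hq ↦ hsuper q ?_⟩
  -- the Lipschitz estimate along the distance
  have hball : q ∈ D.metric.ball y (ENNReal.ofReal ρ₀) := by
    rw [PseudoRiemannianMetric.mem_ball, PseudoRiemannianMetric.riemEDist_eq D.isRiemannian_metric]
    exact hq
  have hlip := Literature.Geometry.Riemannian.ofReal_abs_sub_le_mul_riemEDist D.metric
    D.isRiemannian_metric isOpen_univ hϱd1.contMDiffOn (L := L)
    (fun z _ v ↦ by rw [hLcoe]; exact hgrad z v) (x := y) (ρ := ENNReal.ofReal ρ₀)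
    (subset_univ _) hball
  have hlt : ENNReal.ofReal |ϱ y - ϱ q| < ENNReal.ofReal ((L : ℝ) * ρ₀ + 1) := by
    have h1 : (L : ENNReal) * D.metric.riemEDist y q ≤ (L : ENNReal) * ENNReal.ofReal ρ₀ :=
      mul_le_mul_of_nonneg_left (le_of_lt (PseudoRiemannianMetric.mem_ball.1 hball)) bot_le
    have h2 : (L : ENNReal) * ENNReal.ofReal ρ₀ = ENNReal.ofReal ((L : ℝ) * ρ₀) := by
      rw [ENNReal.ofReal_mul L.coe_nonneg, ENNReal.ofReal_coe_nnreal]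
    calc ENNReal.ofReal |ϱ y - ϱ q| ≤ (L : ENNReal) * D.metric.riemEDist y q := hlip
      _ ≤ ENNReal.ofReal ((L : ℝ) * ρ₀) := h1.trans_eq h2
      _ < ENNReal.ofReal ((L : ℝ) * ρ₀ + 1) := by
          rw [ENNReal.ofReal_lt_ofReal_iff (by positivity)]
          linarith
  rw [ENNReal.ofReal_lt_ofReal_iff (by positivity)] at hlt
  have habs := abs_sub_lt_iff.1 hlt
  linarith [habs.1, habs.2]

/-- **Far out in a sole asymptotically flat end: loop-trivial regions containing balls of every
radius** — the hypothesis `hend` of `InitialDataSet.simplyConnectedSpace_of_kids_of_far_balls`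
(`KIDSimplyConnected.lean`) for one-ended asymptotically flat data of order `α > 0`: for every
`ρ₀` there are `y` and `U` (a far region of the end) such that every loop in `U` at `y` is
null-homotopic in `X` (`homotopicRel_const_of_forall_mem_far`) and the `h`-ball of radius `ρ₀`
about `y` lies in `U` (`exists_edist_ball_subset_far`). [cite: BeigChrusciel1996, Thm. 4.1 (hypotheses: ends ≅ ℝ³ ∖ B(R))] -/
theorem exists_far_loopTrivial_ball [D.metric.HasLeviCivita] {α : ℝ} (hα : 0 < α)
    (haf : e.IsAsymptoticallyFlat D α) (ρ₀ : ℝ) :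
    ∃ (y : X) (U : Set X),
      (∀ γ : C(unitInterval, X), (∀ t, γ t ∈ U) → γ 0 = y → γ 1 = y →
        γ.HomotopicRel (ContinuousMap.const unitInterval y) {0, 1}) ∧
      {q | D.metric.edist D.isRiemannian_metric y q < ENNReal.ofReal ρ₀} ⊆ U := by
  have haf' := haf.isStronglyAsymptoticallyFlatWith_zero (β := α / 2) (γ := α) (by linarith)
    (by linarith)
  obtain ⟨y, hy⟩ := exists_edist_ball_subset_far (e := e) (D := D) (by linarith) haf' e.R ρ₀
  exact ⟨y, e.far e.R, fun γ hγ h0 h1 ↦ e.homotopicRel_const_of_forall_mem_far le_rfl γ hγ h0 h1,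
    hy⟩

end FarBalls

end AFEnd

end Literature.Geometry.Lorentzian

end
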